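import Summits.Ventures.PercRepro.Night2FatXLine

/-!
# night-2: the two kinds of loads above `Q ∪ {x}` — a distance-1 source erases an off-point, a source without
# good points has its line coplanar with the two off-points

In the fat case `G ∖ clF B₀ = {w₀, x}` a lossy big pair `(B, z)` contains at most one of `w₀, x`
(`notMem_or_notMem_insert_of_loss_ne_zero`).  Hence:

* a **distance-1** load `T = Q ∪ {x'}` at a target containing both off-points has `x' ∈ {w₀, x}`
  (`erase_off_point_of_dist_one_fat`): the source is `T ∖ {x}` or `T ∖ {w₀}`;
* a lossy big pair **without good points** has exactly one off-point `u` outside `Q`; the other, `v`, lies in `Q`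
  (else every face closure is inside `clF B₀` and `u` is a good point) and is a coloop of `Q' = Q ∖ K` whose face
  has its closure inside `clF B₀`, so `u` is off that face; without good points `u` lies on the two other face
  hyperplanes, which meet (modularity, `rkN_inter_clF_add_le`) in the rank-`4` flat spanned by the line
  `R = Q' ∖ coloops Q'`, `v` and `K`: **`rk (R ∪ {w₀, x}) ≤ 3`** (`rkN_line_off_le_three_of_no_gtPts`).

The dichotomy `loaded_fat_target_dichotomy` (Night2FatXDichotomy) combines both.  Paper `proofs/NIGHT-2-g33.md` §4.
-/

namespace PercRepro.Shadow

open PercRepro.ThmH PercRepro.PerFlat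

variable {α : Type*} [DecidableEq α] {M : Matroid α} [M.Finite] {G : Finset α}

/-- In the fat case a rank-`2` set of `G` with at least three points that misses one off-point misses the other. -/
theorem notMem_of_rkN_le_two_of_notMem (hs : ∀ e ∈ gr M, ∀ f ∈ gr M, e ≠ f → rkN M {e, f} = 2)
    (hG : G ∈ flatsQ M (5 + 1)) {B₀ : Finset α} {w₀ x : α} (hD : G \ clF M B₀ = {w₀, x}) {R : Finset α}
    (hRG : R ⊆ G) (h2 : rkN M R ≤ 2) (h3 : 3 ≤ R.card) {u v : α} (huv : ({w₀, x} : Finset α) = {u, v})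
    (hvR : v ∉ R) : u ∉ R := by
  intro huR
  have hRgr : R ⊆ gr M := hRG.trans (mem_flatsQ.1 hG).1
  have hu : u ∈ G \ clF M B₀ := by
    rw [hD, huv]
    exact Finset.mem_insert_self _ _
  have h2' : 1 < (R.erase u).card := by
    rw [Finset.card_erase_of_mem huR]
    omega
  obtain ⟨r₁, hr₁, r₂, hr₂, hne⟩ := Finset.one_lt_card.1 h2'
  have hcl : ∀ r ∈ R.erase u, r ∈ clF M B₀ := by
    intro r hr
    rw [Finset.mem_erase] at hr
    by_contra hc
    have hmem : r ∈ G \ clF M B₀ := Finset.mem_sdiff.2 ⟨hRG hr.2, hc⟩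
    rw [hD, huv, Finset.mem_insert, Finset.mem_singleton] at hmem
    rcases hmem with rfl | rfl
    · exact hr.1 rfl
    · exact hvR hr.2
  have hsub := subset_clF_of_rkN_le_two_of_two_mem hs hRgr h2 (Finset.mem_of_mem_erase hr₁)
    (Finset.mem_of_mem_erase hr₂) hne (hcl r₁ hr₁) (hcl r₂ hr₂)
  exact (Finset.mem_sdiff.1 hu).2 (hsub huR)

/-- **A distance-1 load at a target containing both off-points erases one of them**: `x' ∈ {w₀, x}`. -/
theorem erase_off_point_of_dist_one_fat (hG : G ∈ flatsQ M (5 + 1)) (hd : (gr M \ G).card = 2)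
    (hk : kColoops M G = 1) (hs : ∀ e ∈ gr M, ∀ f ∈ gr M, e ≠ f → rkN M {e, f} = 2)
    (hl : ∀ e ∈ gr M, M.Indep {e}) {B₀ : Finset α} (hB₀ : B₀ ∈ thinMembers M 5 G) {w₀ x : α}
    (hD : G \ clF M B₀ = {w₀, x}) {B : Finset α} (hB : B ∈ thinMembers M 5 G)
    (hbig : 5 ≤ (B \ coloops M G).card) {z : α} (hz : z ∈ G \ clF M B) (h : loss M 5 G B z ≠ 0)
    {x' : α} (hw₀ : w₀ ∈ insert x' (insert z B)) (hx : x ∈ insert x' (insert z B)) : x' = w₀ ∨ x' = x := by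
  rw [Finset.mem_insert] at hw₀ hx
  rcases notMem_or_notMem_insert_of_loss_ne_zero hG hd hk hs hl hB₀ hD hB hbig hz h with h1 | h1
  · left
    rcases hw₀ with h' | h'
    · exact h'.symm
    · exact absurd h' h1
  · right
    rcases hx with h' | h'
    · exact h'.symm
    · exact absurd h' h1

/-- The line of a lossy big set: `R = Q' ∖ coloops Q'` (`Q' = (B ∪ {z}) ∖ K`) has rank `2` and `|R| + 3 = |Q'|`. -/
theorem rkN_sdiff_coloops_eq_two_of_loss_ne_zero (hG : G ∈ flatsQ M (5 + 1)) (hd : (gr M \ G).card = 2)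
    (hk : kColoops M G = 1) (hs : ∀ e ∈ gr M, ∀ f ∈ gr M, e ≠ f → rkN M {e, f} = 2)
    (hl : ∀ e ∈ gr M, M.Indep {e}) {B : Finset α} (hB : B ∈ thinMembers M 5 G)
    (hbig : 5 ≤ (B \ coloops M G).card) {z : α} (hz : z ∈ G \ clF M B) (h : loss M 5 G B z ≠ 0) :
    rkN M ((insert z B \ coloops M G) \ coloops M (insert z B \ coloops M G)) = 2 ∧
      ((insert z B \ coloops M G) \ coloops M (insert z B \ coloops M G)).card + 3 =
        (insert z B \ coloops M G).card := by
  have hGg : G ⊆ gr M := (mem_flatsQ.1 hG).1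
  have hQG : insert z B ⊆ G :=
    Finset.insert_subset (Finset.mem_sdiff.1 hz).1 (subset_G_of_mem_thinMembers hB)
  set Q' := insert z B \ coloops M G with hQ'
  have hQ'g : Q' ⊆ gr M := Finset.sdiff_subset.trans (hQG.trans hGg)
  have hc3 : (coloops M Q').card = 3 := card_coloops_eq_three_of_loss_ne_zero hG hd hk hs hl hB hbig hz h
  have h5 : rkN M Q' = 5 := rkN_insert_sdiff_coloops_eq_five_of_thin hG hd hk hB hz
  have hsplit := eRk_eq_card_coloops_add_sdiff (M := M) hQ'g
  rw [eRk_eq_rkN, eRk_eq_rkN, h5, hc3] at hsplit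
  have hrk : rkN M (Q' \ coloops M Q') = 2 := by
    have : ((5 : ℕ) : ℕ∞) = ((3 : ℕ) : ℕ∞) + ((rkN M (Q' \ coloops M Q') : ℕ) : ℕ∞) := hsplit
    rw [← Nat.cast_add] at this
    have := Nat.cast_injective (R := ℕ∞) this
    omega
  refine ⟨hrk, ?_⟩
  have hKsub : coloops M Q' ⊆ Q' := fun y hy => (mem_coloops.1 hy).1
  rw [Finset.card_sdiff_of_subset hKsub, hc3]
  have : 3 ≤ Q'.card := by
    have := Finset.card_le_card hKsub
    omega
  omega

/-- **The line of a lossy big pair without good points is coplanar with the two off-points**: in the fat case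
`G ∖ clF B₀ = {w₀, x}`, a lossy big pair `(B, z)` with `gtPts (B ∪ {z}) = ∅` has exactly one off-point `u` outside
`Q = B ∪ {z}`, the other `v` is a coloop of `Q' = Q ∖ K` whose face has its closure inside `clF B₀` (so `u` is off
it), and without good points `u` lies on the two other face hyperplanes, which meet in the flat spanned by `R`,
`v` and `K` (modularity): `rk (R ∪ {w₀, x}) ≤ 3` for the line `R = Q' ∖ coloops Q'`. -/
theorem rkN_line_off_le_three_of_no_gtPts (hG : G ∈ flatsQ M (5 + 1)) (hd : (gr M \ G).card = 2)
    (hk : kColoops M G = 1) (hs : ∀ e ∈ gr M, ∀ f ∈ gr M, e ≠ f → rkN M {e, f} = 2)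
    (hl : ∀ e ∈ gr M, M.Indep {e}) {B₀ : Finset α} (hB₀ : B₀ ∈ thinMembers M 5 G) {w₀ x : α}
    (hD : G \ clF M B₀ = {w₀, x}) {B : Finset α} (hB : B ∈ thinMembers M 5 G)
    (hbig : 5 ≤ (B \ coloops M G).card) {z : α} (hz : z ∈ G \ clF M B) (h : loss M 5 G B z ≠ 0)
    (hno : ¬ (gtPts M 5 G (insert z B)).Nonempty) :
    rkN M (insert w₀ (insert x ((insert z B \ coloops M G) \ coloops M (insert z B \ coloops M G)))) ≤ 3 := by
  have hGg : G ⊆ gr M := (mem_flatsQ.1 hG).1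
  have hd' : (gr M \ G).card ≤ 5 := by omega
  have hQG : insert z B ⊆ G :=
    Finset.insert_subset (Finset.mem_sdiff.1 hz).1 (subset_G_of_mem_thinMembers hB)
  have hKB : coloops M G ⊆ B := coloops_subset_of_mem_thinMembers hG hd' hB
  have hKQ : coloops M G ⊆ insert z B := hKB.trans (Finset.subset_insert _ _)
  obtain ⟨hR2, hRcard⟩ := rkN_sdiff_coloops_eq_two_of_loss_ne_zero hG hd hk hs hl hB hbig hz h
  obtain ⟨R, hRdef⟩ : ∃ R : Finset α,
      R = (insert z B \ coloops M G) \ coloops M (insert z B \ coloops M G) := ⟨_, rfl⟩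
  rw [← hRdef] at hR2 hRcard ⊢
  have hc3 : (coloops M (insert z B \ coloops M G)).card = 3 :=
    card_coloops_eq_three_of_loss_ne_zero hG hd hk hs hl hB hbig hz h
  have hQ'5 : rkN M (insert z B \ coloops M G) = 5 := rkN_insert_sdiff_coloops_eq_five_of_thin hG hd hk hB hz
  have hQ'G : insert z B \ coloops M G ⊆ G := Finset.sdiff_subset.trans hQG
  have hRQ' : R ⊆ insert z B \ coloops M G := by
    rw [hRdef]
    exact Finset.sdiff_subset
  have hRG : R ⊆ G := hRQ'.trans hQ'G
  have hzB : z ∉ B := fun h' => (Finset.mem_sdiff.1 hz).2 (subset_clF_of_subset_gr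
    ((subset_G_of_mem_thinMembers hB).trans hGg) h')
  have hzK : z ∉ coloops M G := fun h' => hzB (hKB h')
  have hR3 : 3 ≤ R.card := by
    have heq : insert z B \ coloops M G = insert z (B \ coloops M G) := by
      ext e
      simp only [Finset.mem_sdiff, Finset.mem_insert]
      constructor
      · rintro ⟨h' | h', h2⟩
        · exact Or.inl h'
        · exact Or.inr ⟨h', h2⟩
      · rintro (rfl | ⟨h', h2⟩)
        · exact ⟨Or.inl rfl, hzK⟩
        · exact ⟨Or.inr h', h2⟩
    have : 6 ≤ (insert z B \ coloops M G).card := by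
      rw [heq, Finset.card_insert_of_notMem (fun h' => hzB (Finset.mem_sdiff.1 h').1)]
      omega
    omega
  have hoff := notMem_or_notMem_insert_of_loss_ne_zero hG hd hk hs hl hB₀ hD hB hbig hz h
  have hfaces := thinFacesOf_eq_image_erase hG hd hk hs hl hB hbig hz h
  have hrkQ : rkN M (insert z B) = 6 := by
    rw [rkN_eq_rkN_sdiff_add_one hG hk hQG (Finset.Subset.refl _) hKQ, hQ'5]
  -- each coloop face has rank `5`
  have hrkface : ∀ c, c ∈ coloops M (insert z B \ coloops M G) → rkN M ((insert z B).erase c) = 5 := by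
    intro c hcC
    have hcQ' : c ∈ insert z B \ coloops M G := (mem_coloops.1 hcC).1
    have hcQ : c ∈ insert z B := (Finset.mem_sdiff.1 hcQ').1
    have hcK : c ∉ coloops M G := (Finset.mem_sdiff.1 hcQ').2
    have hKc : coloops M G ⊆ (insert z B).erase c := by
      intro e he
      exact Finset.mem_erase.2 ⟨fun h' => hcK (h' ▸ he), hKQ he⟩
    have heq : (insert z B).erase c \ coloops M G = (insert z B \ coloops M G).erase c := by
      ext e
      simp only [Finset.mem_sdiff, Finset.mem_erase]
      constructor
      · rintro ⟨⟨h1, h2⟩, h3⟩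
        exact ⟨h1, h2, h3⟩
      · rintro ⟨h1, h2, h3⟩
        exact ⟨⟨h1, h2⟩, h3⟩
    have hsubG : (insert z B).erase c ⊆ G := (Finset.erase_subset _ _).trans hQG
    rw [rkN_eq_rkN_sdiff_add_one hG hk hsubG (Finset.Subset.refl _) hKc, heq]
    have hnot : c ∉ clF M ((insert z B \ coloops M G).erase c) := (mem_coloops.1 hcC).2
    have := rkN_insert_of_notMem_clF (M := M) (hGg (hQ'G hcQ')) hnot
    rw [Finset.insert_erase hcQ', hQ'5] at this
    omega
  -- the symmetric core: `u ∉ Q`, `v` the other off-point, `{w₀, x} = {u, v}`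
  have core : ∀ u v : α, ({w₀, x} : Finset α) = {u, v} → u ∉ insert z B →
      rkN M (insert u (insert v R)) ≤ 3 := by
    intro u v huv huQ
    have huD : u ∈ G \ clF M B₀ := by
      rw [hD, huv]
      exact Finset.mem_insert_self _ _
    have hvD : v ∈ G \ clF M B₀ := by
      rw [hD, huv]
      exact Finset.mem_insert_of_mem (Finset.mem_singleton_self _)
    have huG : u ∈ G := (Finset.mem_sdiff.1 huD).1
    have hvG : v ∈ G := (Finset.mem_sdiff.1 hvD).1
    have hucl : u ∉ clF M B₀ := (Finset.mem_sdiff.1 huD).2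
    -- every point of `G` other than `u, v` lies in `clF B₀`
    have hin : ∀ e ∈ G, e ≠ u → e ≠ v → e ∈ clF M B₀ := by
      intro e heG heu hev
      by_contra hc
      have hmem : e ∈ G \ clF M B₀ := Finset.mem_sdiff.2 ⟨heG, hc⟩
      rw [hD, huv, Finset.mem_insert, Finset.mem_singleton] at hmem
      rcases hmem with h' | h'
      · exact heu h'
      · exact hev h'
    -- `v ∈ Q`: otherwise every face closure lies in `clF B₀` and `u` would be a good point
    have hvQ : v ∈ insert z B := by
      by_contra hvQ
      apply hno
      refine ⟨u, mem_goodPts.2 ⟨Finset.mem_sdiff.2 ⟨huG, huQ⟩, ?_⟩⟩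
      have hempty : (thinFacesOf M 5 G (insert z B)).filter (fun F => u ∈ clF M F) = ∅ := by
        rw [Finset.filter_eq_empty_iff]
        intro F hF huF
        rw [hfaces, Finset.mem_image] at hF
        obtain ⟨c, -, rfl⟩ := hF
        have hsub : (insert z B).erase c ⊆ clF M B₀ := by
          intro e he
          have heQ : e ∈ insert z B := Finset.mem_of_mem_erase he
          exact hin e (hQG heQ) (fun h' => huQ (h' ▸ heQ)) (fun h' => hvQ (h' ▸ heQ))
        exact hucl (clF_subset_clF_of_subset_clF hsub huF)
      rw [hempty, Finset.card_empty]
      omega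
    -- `v ∉ R` (the line misses `u`, hence `v`), so `v` is a coloop of `Q'`
    have huR : u ∉ R := fun h' => huQ (Finset.mem_sdiff.1 (hRQ' h')).1
    have hvR : v ∉ R := notMem_of_rkN_le_two_of_notMem hs hG hD hRG (by omega) hR3
      (by rw [huv]; exact Finset.pair_comm _ _) huR
    have hvK : v ∉ coloops M G := by
      intro hvK
      have h1 : v ∈ B₀ := coloops_subset_of_mem_thinMembers hG hd' hB₀ hvK
      have h2 : v ∈ clF M B₀ :=
        subset_clF_of_subset_gr ((subset_G_of_mem_thinMembers hB₀).trans hGg) h1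
      exact (Finset.mem_sdiff.1 hvD).2 h2
    have hvQ' : v ∈ insert z B \ coloops M G := Finset.mem_sdiff.2 ⟨hvQ, hvK⟩
    have hvC : v ∈ coloops M (insert z B \ coloops M G) := by
      by_contra hc
      exact hvR (by rw [hRdef]; exact Finset.mem_sdiff.2 ⟨hvQ', hc⟩)
    -- the face at `v` has its closure inside `clF B₀`, so `u` is off it
    have hFv : (insert z B).erase v ∈ thinFacesOf M 5 G (insert z B) := by
      rw [hfaces, Finset.mem_image]
      exact ⟨v, hvC, rfl⟩
    have huFv : u ∉ clF M ((insert z B).erase v) := by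
      intro h'
      have hsub : (insert z B).erase v ⊆ clF M B₀ := by
        intro e he
        have heQ : e ∈ insert z B := Finset.mem_of_mem_erase he
        exact hin e (hQG heQ) (fun h'' => huQ (h'' ▸ heQ)) (fun h'' => (Finset.mem_erase.1 he).1 h'')
      exact hucl (clF_subset_clF_of_subset_clF hsub h')
    -- the two other coloops `c₂ ≠ c₃`
    have h2 : 1 < ((coloops M (insert z B \ coloops M G)).erase v).card := by
      rw [Finset.card_erase_of_mem hvC, hc3]
      norm_num
    obtain ⟨c₂, hc₂, c₃, hc₃, hc23⟩ := Finset.one_lt_card.1 h2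
    have hc₂v : c₂ ≠ v := (Finset.mem_erase.1 hc₂).1
    have hc₃v : c₃ ≠ v := (Finset.mem_erase.1 hc₃).1
    have hc₂C : c₂ ∈ coloops M (insert z B \ coloops M G) := Finset.mem_of_mem_erase hc₂
    have hc₃C : c₃ ∈ coloops M (insert z B \ coloops M G) := Finset.mem_of_mem_erase hc₃
    have hc₂K : c₂ ∉ coloops M G := (Finset.mem_sdiff.1 (mem_coloops.1 hc₂C).1).2
    have hc₃K : c₃ ∉ coloops M G := (Finset.mem_sdiff.1 (mem_coloops.1 hc₃C).1).2
    -- `u` lies on the faces at `c₂` and `c₃` (no good point)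
    have hface : ∀ c, c ∈ coloops M (insert z B \ coloops M G) → c ≠ v →
        u ∈ clF M ((insert z B).erase c) := by
      intro c hcC hcv
      have hF : (insert z B).erase c ∈ thinFacesOf M 5 G (insert z B) := by
        rw [hfaces, Finset.mem_image]
        exact ⟨c, hcC, rfl⟩
      refine mem_clF_of_not_gtPts hG hd hk hs hl hB hbig hz h hno (Finset.mem_sdiff.2 ⟨huG, huQ⟩)
        hFv huFv hF ?_
      intro heq
      have hv' : v ∈ (insert z B).erase c := Finset.mem_erase.2 ⟨fun h' => hcv h'.symm, hvQ⟩
      rw [heq] at hv'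
      exact (Finset.mem_erase.1 hv').1 rfl
    have hu₂ := hface c₂ hc₂C hc₂v
    have hu₃ := hface c₃ hc₃C hc₃v
    have hunion : (insert z B).erase c₂ ∪ (insert z B).erase c₃ = insert z B := by
      ext e
      simp only [Finset.mem_union, Finset.mem_erase]
      constructor
      · rintro (⟨-, h'⟩ | ⟨-, h'⟩) <;> exact h'
      · intro heQ
        by_cases he : e = c₂
        · exact Or.inr ⟨fun h' => hc23 (he.symm.trans h'), heQ⟩
        · exact Or.inl ⟨he, heQ⟩
    have hsub₂ : (insert z B).erase c₂ ⊆ gr M := ((Finset.erase_subset _ _).trans hQG).trans hGg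
    have hsub₃ : (insert z B).erase c₃ ⊆ gr M := ((Finset.erase_subset _ _).trans hQG).trans hGg
    have hmod := rkN_inter_clF_add_le (M := M) hsub₂ hsub₃
    rw [hunion, hrkQ, hrkface c₂ hc₂C, hrkface c₃ hc₃C] at hmod
    -- `insert u (insert v R) ∪ K` lies in the intersection of the two face closures
    have hmem₂ : ∀ e, e ∈ insert v R ∪ coloops M G → e ∈ (insert z B).erase c₂ := by
      intro e he
      rw [Finset.mem_union, Finset.mem_insert] at he
      rcases he with (rfl | heR) | heK
      · exact Finset.mem_erase.2 ⟨fun h' => hc₂v h'.symm, hvQ⟩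
      · have heQ : e ∈ insert z B := (Finset.mem_sdiff.1 (hRQ' heR)).1
        have heC : e ∉ coloops M (insert z B \ coloops M G) := by
          rw [hRdef] at heR
          exact (Finset.mem_sdiff.1 heR).2
        exact Finset.mem_erase.2 ⟨fun h' => heC (h' ▸ hc₂C), heQ⟩
      · exact Finset.mem_erase.2 ⟨fun h' => hc₂K (h' ▸ heK), hKQ heK⟩
    have hmem₃ : ∀ e, e ∈ insert v R ∪ coloops M G → e ∈ (insert z B).erase c₃ := by
      intro e he
      rw [Finset.mem_union, Finset.mem_insert] at he
      rcases he with (rfl | heR) | heK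
      · exact Finset.mem_erase.2 ⟨fun h' => hc₃v h'.symm, hvQ⟩
      · have heQ : e ∈ insert z B := (Finset.mem_sdiff.1 (hRQ' heR)).1
        have heC : e ∉ coloops M (insert z B \ coloops M G) := by
          rw [hRdef] at heR
          exact (Finset.mem_sdiff.1 heR).2
        exact Finset.mem_erase.2 ⟨fun h' => heC (h' ▸ hc₃C), heQ⟩
      · exact Finset.mem_erase.2 ⟨fun h' => hc₃K (h' ▸ heK), hKQ heK⟩
    have hS₀sub : insert u (insert v R ∪ coloops M G) ⊆
        clF M ((insert z B).erase c₂) ∩ clF M ((insert z B).erase c₃) := by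
      intro e he
      rw [Finset.mem_insert] at he
      rw [Finset.mem_inter]
      rcases he with rfl | he
      · exact ⟨hu₂, hu₃⟩
      · exact ⟨subset_clF_of_subset_gr hsub₂ (hmem₂ e he), subset_clF_of_subset_gr hsub₃ (hmem₃ e he)⟩
    have hS₀rk : rkN M (insert u (insert v R ∪ coloops M G)) ≤ 4 := by
      have := rkN_mono (M := M) hS₀sub
      omega
    have hS₀G : insert u (insert v R ∪ coloops M G) ⊆ G := by
      intro e he
      rw [Finset.mem_insert, Finset.mem_union, Finset.mem_insert] at he
      rcases he with rfl | (rfl | heR) | heK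
      · exact huG
      · exact hvG
      · exact hRG heR
      · exact hQG (hKQ heK)
    have hKS₀ : coloops M G ⊆ insert u (insert v R ∪ coloops M G) := fun e he =>
      Finset.mem_insert_of_mem (Finset.mem_union_right _ he)
    have huK : u ∉ coloops M G := by
      intro huK
      exact hucl (subset_clF_of_subset_gr ((subset_G_of_mem_thinMembers hB₀).trans hGg)
        (coloops_subset_of_mem_thinMembers hG hd' hB₀ huK))
    have hS₀K : insert u (insert v R ∪ coloops M G) \ coloops M G = insert u (insert v R) := by
      ext e
      simp only [Finset.mem_sdiff, Finset.mem_insert, Finset.mem_union]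
      constructor
      · rintro ⟨rfl | (rfl | heR) | heK, h2⟩
        · exact Or.inl rfl
        · exact Or.inr (Or.inl rfl)
        · exact Or.inr (Or.inr heR)
        · exact absurd heK h2
      · rintro (rfl | rfl | heR)
        · exact ⟨Or.inl rfl, huK⟩
        · exact ⟨Or.inr (Or.inl (Or.inl rfl)), hvK⟩
        · exact ⟨Or.inr (Or.inl (Or.inr heR)), (Finset.mem_sdiff.1 (hRQ' heR)).2⟩
    have := rkN_eq_rkN_sdiff_add_one hG hk hS₀G (Finset.Subset.refl _) hKS₀
    rw [hS₀K] at this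
    omega
  rcases hoff with hw₀Q | hxQ
  · exact core w₀ x rfl hw₀Q
  · have := core x w₀ (Finset.pair_comm _ _) hxQ
    rwa [Finset.insert_comm] at this

end PercRepro.Shadow
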